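import Summits.ResolutionOfSingularities.ResolutionOfSingularities.Theorems.HilbertSamuelEliminationSigmaMaxModificationsCorridor3WLadderLocalStepComparison
import Literature.AlgebraicGeometry.CossartJannsenSaito2020.BlowupTowerLocalizeTransfer
import Literature.AlgebraicGeometry.Resolution.BlowupSequencesRestrictMarked
import HarnessLib

/-!
# [OURS · L1 W4.2] THE LOCAL TOWER of a sequence of genuine steps: iterated blow-ups of closed points over
# `Spec 𝒪_{X_{n_0},x_{n_0}}` realising the local rings of the marked points — grade 1 / units-half of `stub_Wlow3M_char`
# (crux chain w42, line `w_ladder`; `--supports stmt-ResolutionOfSingularities-19249`, helper)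

OURS (cell res-hironaka, slot W4.2, seat res-L1-w42-stub-2 gen 3); NOT statements of H. Hironaka's manuscript
[Hironaka2017]. AI-drafted, weaker than expert review. Sorry-free PROOF file (no new definition), fact-free: the
RECURSION assembling `…Corridor3WLadderLocalPointBlowup` / `…LocalStepComparison` into a `BlowupTower` (res-type-053's
carrier of CJS Def. 6.34 / 6.38, `KeyTheorems.lean`), CJS p. 107 («the claims on the fundamental sequences … depend only
on the localization `X_x = Spec(𝒪_{X,x})`»).

INPUT — «a sequence of genuine steps» (what a MOVING chain with `e ≤ 1` at its blown-up points supplies, by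
`…Corridor3WLadderBlownUpCentre`: the canonical centre is `𝔪` at the marked point; the waiting segments supply the links):
for every `j`, a blow-up `π_j : X'_j → X_j` in a centre `C_j = 𝓘(V(C_j))` with `(C_j)_{x_j} = 𝔪_{x_j}`, a CLOSED point
`x'_j ∈ X'_j` over `x_j`, and an isomorphism of local rings `𝒪_{X'_j,x'_j} ≅ 𝒪_{X_{j+1},x_{j+1}}`.

OUTPUT — `Moving.exists_localTower`: a tower `T` with `T.X 0 = Spec 𝒪_{X_0,x_0}`, `T.X (j+1) = Bℓ_{y_j}(T.X j)` (the centres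
are the reduced closed points `T.C j = {y_j}`), closed points `y_{j+1} ↦ y_j`, and `𝒪_{T.X j, y_j} ≅ 𝒪_{X_j,x_j}` for every `j`;
moreover the SETTING transfers to stage `0` (res-type-053's `keySetting_localize`, `charHypothesis_localize`,
`isIsolatedInHSMaxLocus_localize`, applied to the constant tower on `X_0`): `KeySetting`, `CharHypothesis`, isolation in
the Hilbert–Samuel locus. What remains for grade 1 (next file, consuming the named facts `Thm314_point_locus`,
`ProjDir_line`, `Corollary637_char`): `IsFundamentalSequence T N y_0 ⊤` (centre_one / centre_near / iso / permissible)
and the extraction of the input data from a moving chain.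

## References

* V. Cossart, U. Jannsen, S. Saito, LNM 2270 (2020): p. 107, Def. 6.34, Def. 6.38, Cor. 6.37, Thm. 6.40. [CossartJannsenSaito2020]
* U. Görtz, T. Wedhorn, *Algebraic Geometry I* (2nd ed. 2020), Def. 13.90, Prop. 13.91. [GortzWedhorn2020]
-/

noncomputable section

-- namespace `…Corridor3.Moving` re-enters `…Corridor3` (module convention of the Moving files)
set_option linter.dupNamespace false

open CategoryTheory CategoryTheory.Limits AlgebraicGeometry TopologicalSpace IsLocalRing
open Literature.AlgebraicGeometry.Resolution Literature.RingTheory.HilbertSamuel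
open Scheme.IdealSheafData

universe u

open Literature.AlgebraicGeometry.CossartJannsenSaito2020

namespace Summit.ResolutionOfSingularities.ResolutionOfSingularities.Theorems.SigmaMaxModificationsCorridor3.Moving

-- `CentreSeq.isLocallyNoetherian_blowup` (tree `BlowupSequencesRestrictMarked`): the chosen blow-up is locally noetherian.

/-- The identity is a blow-up in the empty (reduced) centre. [cite: GortzWedhorn2020, (13.19) p. 413] -/
theorem isBlowup_id_vanishingIdeal_empty (Y : Scheme.{u}) :
    IsBlowup (𝟙 Y) (vanishingIdeal (⟨∅, isClosed_empty⟩ : Closeds Y)) := by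
  have h : (⟨∅, isClosed_empty⟩ : Closeds Y) = ⊥ := rfl
  rw [h, vanishingIdeal_bot]
  exact isBlowup_id_top Y

/-- **THE LOCAL TOWER** (see the module docstring): from a sequence of genuine steps — blow-ups `π_j : X'_j → X_j` in
centres `C_j = 𝓘(V(C_j))` with `(C_j)_{x_j} = 𝔪_{x_j}`, closed points `x'_j` over `x_j`, links
`𝒪_{X'_j,x'_j} ≅ 𝒪_{X_{j+1},x_{j+1}}` — a tower of blow-ups of closed points over `Spec 𝒪_{X_0,x_0}` whose marked closed
points `y_j` have the local rings `𝒪_{X_j,x_j}`, with the setting (excellence and dimension, (F1), isolation in the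
Hilbert–Samuel locus) transferred to stage `0`. [cite: CossartJannsenSaito2020, p. 107, Def. 6.34, Def. 6.38] -/
theorem exists_localTower {W W' : ℕ → Scheme.{u}} [hW : ∀ j, IsLocallyNoetherian (W j)]
    (π : ∀ j, W' j ⟶ W j) (C : ∀ j, (W j).IdealSheafData) (hπ : ∀ j, IsBlowup (π j) (C j))
    (hC : ∀ j, C j = vanishingIdeal (C j).support) (x : ∀ j, W j)
    (hx : ∀ j, stalkIdeal (C j) (x j) = maximalIdeal ((W j).presheaf.stalk (x j))) (x' : ∀ j, W' j)
    (hx' : ∀ j, (π j).base (x' j) = x j) (hcl : ∀ j, IsClosed ({x' j} : Set (W' j)))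
    (link : ∀ j, Nonempty ((W' j).presheaf.stalk (x' j) ≅ (W (j + 1)).presheaf.stalk (x (j + 1)))) :
    ∃ (T : BlowupTower.{u}) (y : ∀ j, T.X j),
      (∀ j, T.C j = {y j}) ∧ (∀ j, IsClosed ({y j} : Set (T.X j))) ∧ (∀ j, (T.π j).base (y (j + 1)) = y j) ∧
      (∀ j, Nonempty ((T.X j).presheaf.stalk (y j) ≅ (W j).presheaf.stalk (x j))) ∧
      (∀ N : ℕ, Scheme.IsExcellent (W 0) → topologicalKrullDim (W 0) ≤ (N : WithBot ℕ∞) → KeySetting T N) ∧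
      (CharHypothesis (W 0) (x 0) → CharHypothesis (T.X 0) (y 0)) ∧
      (∀ N : ℕ, (∀ w : W 0, w ⤳ x 0 → Scheme.hsFun (W 0) N w ≤ Scheme.hsFun (W 0) N (x 0)) →
        IsIsolatedInHSMaxLocus (W 0) N (x 0) → @IsIsolatedInHSMaxLocus (T.X 0) (T.ln 0) N (y 0)) := by
  classical
  -- the state reached after `j` blow-ups: a stage, its marked closed point, and the identification of local rings
  let St : ℕ → Type (u + 1) := fun j =>
    Σ' (Y : Scheme.{u}) (_ : IsLocallyNoetherian Y) (y : Y) (_ : IsClosed ({y} : Set Y)),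
      Y.presheaf.stalk y ≅ (W j).presheaf.stalk (x j)
  -- stage 0: the local scheme of `X_0` at `x_0`
  let st0 : St 0 :=
    ⟨Spec ((W 0).presheaf.stalk (x 0)), inferInstance, closedPoint ((W 0).presheaf.stalk (x 0)),
      isClosed_singleton_of_fromSpecStalk_eq Scheme.fromSpecStalk_closedPoint,
      haveI := isIso_stalkMap_fromSpecStalk (W 0) (x 0) (closedPoint ((W 0).presheaf.stalk (x 0)))
      (asIso (((W 0).fromSpecStalk (x 0)).stalkMap (closedPoint ((W 0).presheaf.stalk (x 0))))).symm ≪≫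
        eqToIso (by rw [Scheme.fromSpecStalk_closedPoint])⟩
  -- the step: blow up the marked point and transport along the genuine step `j`
  let stepFn : ∀ j, St j → St (j + 1) := fun j s =>
    haveI : IsLocallyNoetherian s.1 := s.2.1
    haveI : IsLocallyNoetherian (blowup (vanishingIdeal (⟨{s.2.2.1}, s.2.2.2.1⟩ : Closeds s.1))) :=
      CentreSeq.isLocallyNoetherian_blowup _
    let h := exists_localStep_isClosed s.2.2.2.1 (blowup.isBlowup _) (hπ j) (hC j) (hx j) s.2.2.2.2 (hx' j) (hcl j)
    ⟨blowup (vanishingIdeal (⟨{s.2.2.1}, s.2.2.2.1⟩ : Closeds s.1)), inferInstance, h.choose, h.choose_spec.2.1,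
      Classical.choice h.choose_spec.2.2 ≪≫ Classical.choice (link j)⟩
  let st : ∀ j, St j := fun j => Nat.rec (motive := St) st0 (fun j s => stepFn j s) j
  have st_succ : ∀ j, st (j + 1) = stepFn j (st j) := fun j => rfl
  -- the tower
  let T : BlowupTower.{u} :=
    { X := fun j => (st j).1
      ln := fun j => (st j).2.1
      C := fun j => {(st j).2.2.1}
      isClosed_C := fun j => (st j).2.2.2.1
      π := fun j => blowup.π (vanishingIdeal (⟨{(st j).2.2.1}, (st j).2.2.2.1⟩ : Closeds (st j).1))
      isBlowup := fun j => blowup.isBlowup _ }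
  refine ⟨T, fun j => (st j).2.2.1, fun j => rfl, fun j => (st j).2.2.2.1, fun j => ?_, fun j => ⟨(st j).2.2.2.2⟩,
    ?_, ?_, ?_⟩
  · -- `y_{j+1}` lies over `y_j`: the choice in `stepFn`
    haveI : IsLocallyNoetherian (st j).1 := (st j).2.1
    haveI : IsLocallyNoetherian (blowup (vanishingIdeal (⟨{(st j).2.2.1}, (st j).2.2.2.1⟩ : Closeds (st j).1))) :=
      CentreSeq.isLocallyNoetherian_blowup _
    exact (exists_localStep_isClosed (st j).2.2.2.1 (blowup.isBlowup _) (hπ j) (hC j) (hx j) (st j).2.2.2.2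
      (hx' j) (hcl j)).choose_spec.1
  · -- the setting at stage 0: `Spec 𝒪_{X_0,x_0}` via the constant tower on `X_0`
    intro N hexc hdim
    let T₀ : BlowupTower.{u} :=
      { X := fun _ => W 0, ln := fun _ => hW 0, C := fun _ => ∅, isClosed_C := fun _ => isClosed_empty,
        π := fun _ => 𝟙 (W 0), isBlowup := fun _ => isBlowup_id_vanishingIdeal_empty (W 0) }
    have h := T₀.keySetting_localize (x 0) N ⟨hexc, hdim⟩
    exact ⟨h.excellent, h.dim_le⟩
  · intro hchar
    let T₀ : BlowupTower.{u} :=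
      { X := fun _ => W 0, ln := fun _ => hW 0, C := fun _ => ∅, isClosed_C := fun _ => isClosed_empty,
        π := fun _ => 𝟙 (W 0), isBlowup := fun _ => isBlowup_id_vanishingIdeal_empty (W 0) }
    exact T₀.charHypothesis_localize (x 0) hchar
  · intro N hsc hiso
    let T₀ : BlowupTower.{u} :=
      { X := fun _ => W 0, ln := fun _ => hW 0, C := fun _ => ∅, isClosed_C := fun _ => isClosed_empty,
        π := fun _ => 𝟙 (W 0), isBlowup := fun _ => isBlowup_id_vanishingIdeal_empty (W 0) }
    exact T₀.isIsolatedInHSMaxLocus_localize (x 0) N hsc hiso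

/-- **THE LOCAL TOWER, isolation read on `Spec 𝒪_{X_0,x_0}`** (variant of `exists_localTower`: the isolation of the
marked point of stage `0` in the Hilbert–Samuel locus is taken on the local scheme `Spec 𝒪_{X_0,x_0}` itself, so that it can
be supplied from ANY stage with the same local ring — e.g. an isolated WAITING stage before the first genuine one): from a sequence of genuine steps — blow-ups `π_j : X'_j → X_j` in
centres `C_j = 𝓘(V(C_j))` with `(C_j)_{x_j} = 𝔪_{x_j}`, closed points `x'_j` over `x_j`, links
`𝒪_{X'_j,x'_j} ≅ 𝒪_{X_{j+1},x_{j+1}}` — a tower of blow-ups of closed points over `Spec 𝒪_{X_0,x_0}` whose marked closed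
points `y_j` have the local rings `𝒪_{X_j,x_j}`, with the setting (excellence and dimension, (F1), isolation in the
Hilbert–Samuel locus) transferred to stage `0`. [cite: CossartJannsenSaito2020, p. 107, Def. 6.34, Def. 6.38] -/
theorem exists_localTower_spec {W W' : ℕ → Scheme.{u}} [hW : ∀ j, IsLocallyNoetherian (W j)]
    (π : ∀ j, W' j ⟶ W j) (C : ∀ j, (W j).IdealSheafData) (hπ : ∀ j, IsBlowup (π j) (C j))
    (hC : ∀ j, C j = vanishingIdeal (C j).support) (x : ∀ j, W j)
    (hx : ∀ j, stalkIdeal (C j) (x j) = maximalIdeal ((W j).presheaf.stalk (x j))) (x' : ∀ j, W' j)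
    (hx' : ∀ j, (π j).base (x' j) = x j) (hcl : ∀ j, IsClosed ({x' j} : Set (W' j)))
    (link : ∀ j, Nonempty ((W' j).presheaf.stalk (x' j) ≅ (W (j + 1)).presheaf.stalk (x (j + 1)))) :
    ∃ (T : BlowupTower.{u}) (y : ∀ j, T.X j),
      (∀ j, T.C j = {y j}) ∧ (∀ j, IsClosed ({y j} : Set (T.X j))) ∧ (∀ j, (T.π j).base (y (j + 1)) = y j) ∧
      (∀ j, Nonempty ((T.X j).presheaf.stalk (y j) ≅ (W j).presheaf.stalk (x j))) ∧
      (∀ N : ℕ, Scheme.IsExcellent (W 0) → topologicalKrullDim (W 0) ≤ (N : WithBot ℕ∞) → KeySetting T N) ∧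
      (CharHypothesis (W 0) (x 0) → CharHypothesis (T.X 0) (y 0)) ∧
      (∀ N : ℕ, IsIsolatedInHSMaxLocus (Spec ((W 0).presheaf.stalk (x 0))) N (closedPoint ((W 0).presheaf.stalk (x 0))) →
        @IsIsolatedInHSMaxLocus (T.X 0) (T.ln 0) N (y 0)) := by
  classical
  -- the state reached after `j` blow-ups: a stage, its marked closed point, and the identification of local rings
  let St : ℕ → Type (u + 1) := fun j =>
    Σ' (Y : Scheme.{u}) (_ : IsLocallyNoetherian Y) (y : Y) (_ : IsClosed ({y} : Set Y)),
      Y.presheaf.stalk y ≅ (W j).presheaf.stalk (x j)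
  -- stage 0: the local scheme of `X_0` at `x_0`
  let st0 : St 0 :=
    ⟨Spec ((W 0).presheaf.stalk (x 0)), inferInstance, closedPoint ((W 0).presheaf.stalk (x 0)),
      isClosed_singleton_of_fromSpecStalk_eq Scheme.fromSpecStalk_closedPoint,
      haveI := isIso_stalkMap_fromSpecStalk (W 0) (x 0) (closedPoint ((W 0).presheaf.stalk (x 0)))
      (asIso (((W 0).fromSpecStalk (x 0)).stalkMap (closedPoint ((W 0).presheaf.stalk (x 0))))).symm ≪≫
        eqToIso (by rw [Scheme.fromSpecStalk_closedPoint])⟩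
  -- the step: blow up the marked point and transport along the genuine step `j`
  let stepFn : ∀ j, St j → St (j + 1) := fun j s =>
    haveI : IsLocallyNoetherian s.1 := s.2.1
    haveI : IsLocallyNoetherian (blowup (vanishingIdeal (⟨{s.2.2.1}, s.2.2.2.1⟩ : Closeds s.1))) :=
      CentreSeq.isLocallyNoetherian_blowup _
    let h := exists_localStep_isClosed s.2.2.2.1 (blowup.isBlowup _) (hπ j) (hC j) (hx j) s.2.2.2.2 (hx' j) (hcl j)
    ⟨blowup (vanishingIdeal (⟨{s.2.2.1}, s.2.2.2.1⟩ : Closeds s.1)), inferInstance, h.choose, h.choose_spec.2.1,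
      Classical.choice h.choose_spec.2.2 ≪≫ Classical.choice (link j)⟩
  let st : ∀ j, St j := fun j => Nat.rec (motive := St) st0 (fun j s => stepFn j s) j
  have st_succ : ∀ j, st (j + 1) = stepFn j (st j) := fun j => rfl
  -- the tower
  let T : BlowupTower.{u} :=
    { X := fun j => (st j).1
      ln := fun j => (st j).2.1
      C := fun j => {(st j).2.2.1}
      isClosed_C := fun j => (st j).2.2.2.1
      π := fun j => blowup.π (vanishingIdeal (⟨{(st j).2.2.1}, (st j).2.2.2.1⟩ : Closeds (st j).1))
      isBlowup := fun j => blowup.isBlowup _ }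
  refine ⟨T, fun j => (st j).2.2.1, fun j => rfl, fun j => (st j).2.2.2.1, fun j => ?_, fun j => ⟨(st j).2.2.2.2⟩,
    ?_, ?_, ?_⟩
  · -- `y_{j+1}` lies over `y_j`: the choice in `stepFn`
    haveI : IsLocallyNoetherian (st j).1 := (st j).2.1
    haveI : IsLocallyNoetherian (blowup (vanishingIdeal (⟨{(st j).2.2.1}, (st j).2.2.2.1⟩ : Closeds (st j).1))) :=
      CentreSeq.isLocallyNoetherian_blowup _
    exact (exists_localStep_isClosed (st j).2.2.2.1 (blowup.isBlowup _) (hπ j) (hC j) (hx j) (st j).2.2.2.2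
      (hx' j) (hcl j)).choose_spec.1
  · -- the setting at stage 0: `Spec 𝒪_{X_0,x_0}` via the constant tower on `X_0`
    intro N hexc hdim
    let T₀ : BlowupTower.{u} :=
      { X := fun _ => W 0, ln := fun _ => hW 0, C := fun _ => ∅, isClosed_C := fun _ => isClosed_empty,
        π := fun _ => 𝟙 (W 0), isBlowup := fun _ => isBlowup_id_vanishingIdeal_empty (W 0) }
    have h := T₀.keySetting_localize (x 0) N ⟨hexc, hdim⟩
    exact ⟨h.excellent, h.dim_le⟩
  · intro hchar
    let T₀ : BlowupTower.{u} :=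
      { X := fun _ => W 0, ln := fun _ => hW 0, C := fun _ => ∅, isClosed_C := fun _ => isClosed_empty,
        π := fun _ => 𝟙 (W 0), isBlowup := fun _ => isBlowup_id_vanishingIdeal_empty (W 0) }
    exact T₀.charHypothesis_localize (x 0) hchar
  · intro N hiso
    exact hiso

end Summit.ResolutionOfSingularities.ResolutionOfSingularities.Theorems.SigmaMaxModificationsCorridor3.Moving

end
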